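import Literature.NumberTheory.Automorphic.Liu2021.AppendixC.OmegaHomIsotypicComponentLevelwise
import Literature.NumberTheory.Automorphic.Liu2021.AppendixC.OmegaHomBlockAlgebra
import Literature.NumberTheory.Automorphic.Liu2021.AppendixC.EtaleH1SemisimpleOfHeckeImage
import Literature.RingTheory.SimpleModule.BlockFieldCharacter
import Literature.RingTheory.SimpleModule.CentreOfSemisimpleImage
import Literature.RingTheory.SimpleModule.SemisimpleOfFaithfulModule
import Literature.RingTheory.SimpleModule.SemisimpleBaseChange
import HarnessLib

/-!
# [Liu 2021, p. 133 (D.3) / p. 140] the label character of the block field and its eigenclasses — LEVELWISE (σ-free) edition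
# (the d6 S2′ socket `SocketIso` from «`heckeImage K′` is semisimple for every small level `K′`» instead of `G`-level semisimplicity)

Topic `NumberTheory/Automorphic/Liu2021/AppendixC`; namespace `Literature.NumberTheory.Automorphic.Liu2021.AppendixC.Sec42Data.HeckeTranslates`.
THEOREMS ONLY (no definition, no named fact, no instance, no `sorry`).  LEVELWISE twin of ★ `OmegaHomBlockFieldCharacter` (A-p09 (g14)): the `G`-level
binder `[σ.IsSemisimpleRepresentation]` is replaced by `hssM : ∀ K′, IsSemisimpleModule 𝒜_{K′} (ℚ̄_ℓ ⊗ H¹_ét(A_{K′}))` and, for the block field at the one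
level `K`, `hHK : IsSemisimpleRing (heckeImage K)` — both consequences of «`heckeImage K′` is a semisimple ring for every small `K′`» (road (P) of the
cell's d6 line: a Rosati involution stabilising the Hecke image, [MumfordAV1970] §21 Thm. 1).  Inputs: ★ `OmegaHomIsotypicComponentLevelwise`
(isotypic component ⊆ block values, levelwise), ★ `BlockFieldCharacter` (Schur character along the block field), ★ `CentreOfSemisimpleImage` (`hZ`), ★
`OmegaHomBlockAlgebra` (`𝒜`, `N₀`, `ℚ̄_ℓ ⊗ (heckeImage K)ᵐᵒᵖ ↠ 𝒜`).

* §1 `mem_span_of_forall_comm_of_mul_eq_of_isSemisimpleRing` — the `hZ` discharge of ★ `OmegaHomBlockFieldCharacter` from `hHK` instead of `σ`.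
* §2 **`exists_ringHom_forall_eigen_toTower_baseChange_mem_span_of_levelwise`** — the socket `SocketIso` (label character `τ₀ : R₀ →+* ℂ` of the block
  field; `(ι ∘ τ₀)`-eigenclasses are block values), σ-free: binder for binder ★ `exists_ringHom_forall_eigen_toTower_baseChange_mem_span` with
  `[σ.IsSemisimpleRepresentation]` ↦ `(hssM)` (after `hD`) and `(hHK)` (after `K`); and its one-hypothesis form
  **`…_of_isSemisimpleRing_heckeImage (hH : ∀ K′, IsSemisimpleRing (heckeImage K′))`** over ★ `EtaleH1SemisimpleOfHeckeImage` (A-p10 (g12)).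

Cell `hodgecm-mathlib` (d6 S2′, «S1c eliminator» (O-III), A-plan2 (g12) 2026-08-30 03:03Z): with this file the S1c FACT leaves the `SocketIso` column;
under road (P) the S2′ residue is {`SocketRos`, `SocketMO`}.  Count-neutral; HC_CM is proved only modulo the 7 printed citations until rung 0 closes.

## References
* [Liu2021] Y. Liu, *Fourier–Jacobi cycles and arithmetic relative trace formula*, Camb. J. Math. 9 (2021): p. 133 (D.3) (FJcycle.tex l. 5463–5470), p. 140
  (proof of Thm. D.6 (1), l. 5626), §4.2 (l. 2154–2166), Thm. 4.18 (1) (l. 2239).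
* [Bump1997] D. Bump, *Automorphic Forms and Representations* (1997), §4.2 Prop. 4.2.3 (p. 427).
* [BushnellHenniart2006] C. J. Bushnell, G. Henniart, *The Local Langlands Conjecture for GL(2)* (2006), §4.3 Proposition (2) (pp. 38–39).
* [Lam2001FirstCourse] T. Y. Lam, *A First Course in Noncommutative Rings*, 2nd ed. (2001): §3 Thm. (3.5), Lemma (3.8); §9 Prop. (9.11); §22 Prop. (22.1).
* [BourbakiAlgebreVIII2012] N. Bourbaki, *Algèbre*, Ch. VIII (2012), §3 no. 2 (lemme de Schur).
* [MumfordAV1970] D. Mumford, *Abelian Varieties*, §19 Thm. 3, §21 Thm. 1.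
-/

set_option autoImplicit false

noncomputable section

open CategoryTheory NumberField Function MulAction
open scoped TensorProduct

namespace Literature.NumberTheory.Automorphic.Liu2021.AppendixC

open Literature.AlgebraicGeometry.Motives (AbelianVariety)
open Literature.AlgebraicGeometry.Motives.AbelianVariety (rationalTateModuleMap endAlgebra rationalTateAction rationalTateAction_algebraMap)

variable {F E : Type} [Field F] [NumberField F] [IsTotallyReal F] [Field E] [NumberField E] [Algebra F E]
  [IsTotallyComplex E] [Algebra.IsQuadraticExtension F E]
variable {P5 : PropC5Data F E} {isotropicAt : ℕ → Prop}

namespace Sec42Data.HeckeTranslates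

variable {C : Sec42Data P5 isotropicAt} (T : C.HeckeTranslates) {ℓ : ℕ} [Fact ℓ.Prime]
variable (K : C5.SmallLevel C.S.K₀)
  (hI : ∀ ⦃K K' : C5.SmallLevel C.S.K₀⦄ (f : K' ⟶ K), Function.Injective (rationalTateModuleMap ℓ (C.Atr f)).dualMap)
  (X : C.EtaleHeckeDatum ℓ) (hX : X.rhoEt = T.etHeckeRep ℓ) (ι : ℂ ≃+* AlgebraicClosure ℚ_[ℓ])
  {W : Type} [AddCommGroup W] [Module ℂ W] (ρW : Representation ℂ C.G W)
  {f : W →ₛₗ[(ι : ℂ →+* AlgebraicClosure ℚ_[ℓ])] AlgebraicClosure ℚ_[ℓ] ⊗[ℚ_[ℓ]] C.etaleH1Tower ℓ} (hf : f ∈ X.omegaHom ι ρW)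
  (σ : Representation (AlgebraicClosure ℚ_[ℓ]) C.G (AlgebraicClosure ℚ_[ℓ] ⊗[ℚ_[ℓ]] C.etaleH1Tower ℓ))
  (hσ : ∀ g : C.G, σ g = (X.rhoEt g).baseChange (AlgebraicClosure ℚ_[ℓ]))

/-! ## §1 The `hZ` discharge from `IsSemisimpleRing (heckeImage K)` -/

/-- **Central elements of `𝒜` below `ε` lie in the `ℚ̄_ℓ`-span of the block field.**  Let `heckeImage K` be a semisimple
ring (binder `hHK`; so is `ℚ̄_ℓ ⊗_ℚ (heckeImage K)ᵐᵒᵖ`, ★ `isSemisimpleRing_baseChange`) — the σ-free twin of ★ `mem_span_of_forall_comm_of_mul_eq` —,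
`ε ∈ heckeImage K`, and `φ : R₀ → heckeImage K` with every central `z` of `heckeImage K` having `z ε ∈ φ(R₀)`.  Then every CENTRAL `z ∈ 𝒜` with
`z · (ᵗV_ℓ^ℚ(ε) ⊗ 1) = z` lies in `span_{ℚ̄_ℓ} {ᵗV_ℓ^ℚ(φ r) ⊗ 1}` — the centre of the image `𝒜` of the semisimple `ℚ̄_ℓ ⊗_ℚ (heckeImage K)ᵐᵒᵖ` is the image of
its centre `ℚ̄_ℓ ⊗ Z(heckeImage K)` (★ `CentreOfSemisimpleImage.mem_span_image_of_forall_comm_of_mul_eq`).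
[cite: Lam2001FirstCourse, §3 Lemma (3.8) (p. 35) and §22 Prop. (22.1) (p. 327)] [cite: Liu2021, p. 133 (D.3)] -/
theorem mem_span_of_forall_comm_of_mul_eq_of_isSemisimpleRing (hD : T.IsogenyDescent) (hHK : IsSemisimpleRing ↥(T.heckeImage hD K))
    (S : Set (Module.End (AlgebraicClosure ℚ_[ℓ]) (AlgebraicClosure ℚ_[ℓ] ⊗[ℚ_[ℓ]] C.etaleH1 ℓ K)))
    (hS : S = Set.range fun g : C.G => ((rationalTateAction (C.A K) ℓ (T.heckeEnd hD K g)).dualMap).baseChange (AlgebraicClosure ℚ_[ℓ]))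
    {ε : (C.A K).endAlgebra} (hεH : ε ∈ T.heckeImage hD K)
    {R₀ : Type*} (φ : R₀ → (C.A K).endAlgebra) (hφH : ∀ r, φ r ∈ T.heckeImage hD K)
    (hφsurj : ∀ z ∈ T.heckeImage hD K, (∀ y ∈ T.heckeImage hD K, z * y = y * z) → ∃ r : R₀, φ r = z * ε)
    (e : ↥(Algebra.adjoin (AlgebraicClosure ℚ_[ℓ]) S))
    (he : (e : Module.End (AlgebraicClosure ℚ_[ℓ]) (AlgebraicClosure ℚ_[ℓ] ⊗[ℚ_[ℓ]] C.etaleH1 ℓ K)) =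
      ((rationalTateAction (C.A K) ℓ ε).dualMap).baseChange (AlgebraicClosure ℚ_[ℓ]))
    (a : R₀ → ↥(Algebra.adjoin (AlgebraicClosure ℚ_[ℓ]) S))
    (ha : ∀ r, (a r : Module.End (AlgebraicClosure ℚ_[ℓ]) (AlgebraicClosure ℚ_[ℓ] ⊗[ℚ_[ℓ]] C.etaleH1 ℓ K)) =
      ((rationalTateAction (C.A K) ℓ (φ r)).dualMap).baseChange (AlgebraicClosure ℚ_[ℓ]))
    (z : ↥(Algebra.adjoin (AlgebraicClosure ℚ_[ℓ]) S)) (hz : ∀ x, z * x = x * z) (hze : z * e = z) :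
    z ∈ Submodule.span (AlgebraicClosure ℚ_[ℓ]) (Set.range a) := by
  classical
  obtain ⟨Φ, hΦs, hΦv⟩ := T.exists_algHom_tensor_mulOpposite_heckeImage_surjective K hD S hS
  -- `ℚ̄_ℓ ⊗_ℚ (heckeImage K)ᵐᵒᵖ` is semisimple
  haveI : IsSemisimpleRing ↥(T.heckeImage hD K) := hHK
  haveI : Module.Finite ℚ ↥(T.heckeImage hD K) := T.module_finite_heckeImage hD K
  haveI : IsSemisimpleRing (AlgebraicClosure ℚ_[ℓ] ⊗[ℚ] (↥(T.heckeImage hD K))ᵐᵒᵖ) :=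
    Literature.RingTheory.SimpleModule.isSemisimpleRing_baseChange ℚ (↥(T.heckeImage hD K))ᵐᵒᵖ (AlgebraicClosure ℚ_[ℓ])
  -- every central `c` of `(heckeImage K)ᵐᵒᵖ` has `c · op ε ∈ span_ℚ (op φ(R₀))`
  have hZ₀ : ∀ c : (↥(T.heckeImage hD K))ᵐᵒᵖ, (∀ y, c * y = y * c) →
      c * MulOpposite.op ⟨ε, hεH⟩ ∈ Submodule.span ℚ (Set.range fun r => MulOpposite.op (⟨φ r, hφH r⟩ : ↥(T.heckeImage hD K))) := by
    intro c hc
    have hc₀ : ∀ y ∈ T.heckeImage hD K, ((MulOpposite.unop c : ↥(T.heckeImage hD K)) : (C.A K).endAlgebra) * y =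
        y * ((MulOpposite.unop c : ↥(T.heckeImage hD K)) : (C.A K).endAlgebra) := by
      intro y hy
      have h := congrArg (fun t => ((MulOpposite.unop t : ↥(T.heckeImage hD K)) : (C.A K).endAlgebra)) (hc (MulOpposite.op ⟨y, hy⟩))
      simp only [MulOpposite.unop_mul, MulOpposite.unop_op, Subalgebra.coe_mul] at h
      exact h.symm
    obtain ⟨r, hr⟩ := hφsurj _ (MulOpposite.unop c).2 hc₀
    refine Submodule.subset_span ⟨r, ?_⟩
    change MulOpposite.op (⟨φ r, hφH r⟩ : ↥(T.heckeImage hD K)) = c * MulOpposite.op ⟨ε, hεH⟩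
    rw [← MulOpposite.op_unop c, ← MulOpposite.op_mul]
    congr 1
    apply Subtype.ext
    change φ r = ε * ((MulOpposite.unop c : ↥(T.heckeImage hD K)) : (C.A K).endAlgebra)
    rw [hr]
    exact hc₀ ε hεH
  -- `Φ (1 ⊗ op ε) = e`
  have hΦe : Φ ((1 : AlgebraicClosure ℚ_[ℓ]) ⊗ₜ[ℚ] MulOpposite.op ⟨ε, hεH⟩) = e := Subtype.ext (by rw [hΦv, he])
  have key := Literature.RingTheory.SimpleModule.mem_span_image_of_forall_comm_of_mul_eq (K := ℚ) Φ hΦs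
    (Set.range fun r => MulOpposite.op (⟨φ r, hφH r⟩ : ↥(T.heckeImage hD K))) (MulOpposite.op ⟨ε, hεH⟩) hZ₀ z hz (by rw [hΦe, hze])
  refine (Submodule.span_le.2 ?_) key
  rintro _ ⟨_, ⟨_, ⟨r, rfl⟩, rfl⟩, rfl⟩
  refine Submodule.subset_span ⟨r, Subtype.ext ?_⟩
  rw [ha, hΦv]

end Sec42Data.HeckeTranslates

/-! ## §2 The label character and its eigenclasses — levelwise (the σ-free socket `SocketIso`) -/

namespace Sec42Data.HeckeTranslates

variable {C : Sec42Data P5 isotropicAt} (T : C.HeckeTranslates) (ℓ : ℕ) [Fact ℓ.Prime]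
  (hI : ∀ ⦃K K' : C5.SmallLevel C.S.K₀⦄ (f : K' ⟶ K), Function.Injective (rationalTateModuleMap ℓ (C.Atr f)).dualMap)
  (X : C.EtaleHeckeDatum ℓ) (hX : X.rhoEt = T.etHeckeRep ℓ) (ι : ℂ ≃+* AlgebraicClosure ℚ_[ℓ])
  {W : Type} [AddCommGroup W] [Module ℂ W] (ρW : Representation ℂ C.G W)
  (σ : Representation (AlgebraicClosure ℚ_[ℓ]) C.G (AlgebraicClosure ℚ_[ℓ] ⊗[ℚ_[ℓ]] C.etaleH1Tower ℓ))
  (hσ : ∀ g : C.G, σ g = (X.rhoEt g).baseChange (AlgebraicClosure ℚ_[ℓ]))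

set_option maxHeartbeats 400000 in
include hI hX hσ in
/-- **THE LABEL CHARACTER OF THE BLOCK FIELD, AND ITS EIGENCLASSES ARE BLOCK VALUES — LEVELWISE (σ-free) edition** of ★
`exists_ringHom_forall_eigen_toTower_baseChange_mem_span`: the binder `[σ.IsSemisimpleRepresentation]` is replaced by `hssM` (every `ℚ̄_ℓ ⊗ H¹_ét(A_{K′})`
a semisimple `𝒜_{K′}`-module) and `hHK : IsSemisimpleRing (heckeImage K)` — both consequences of «`heckeImage K′` semisimple for all `K′`» (road (P)). ([Liu2021] (D.3)/p. 140, for the tree's étale tower with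
`G`-level semisimplicity `σ = 1 ⊗ rhoEt` semisimple).  For a small level `K`, a non-zero `f′ ∈ Hom_𝔾(ι_ℓ ∘ ω, ℚ̄_ℓ ⊗ H¹_ét(A_∞))` out of an IRREDUCIBLE `ω`, its
block `ε ∈ heckeImage K` (acting as `1` on the level-`K` classes under `f′(ω^K)`), and a block field `φ : R₀ → Z(heckeImage K)·ε` (`φ` multiplicative,
`φ 1 = ε`, `φ(R₀)` central, every central `z` with `z ε ∈ φ(R₀)`), there is a ring homomorphism `τ₀ : R₀ →+* ℂ` — the LABEL CHARACTER, through which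
`φ(R₀)` acts on `[·]_K⁻¹ f′(ω^K)` — such that every `m ∈ ℚ̄_ℓ ⊗ H¹_ét(A_K)` on which each `ᵗV_ℓ^ℚ(φ r) ⊗ 1` acts as `ι(τ₀ r)` maps under `[·]_K ⊗ 1` into
`span_{ℚ̄_ℓ} {f w | f ∈ Hom_𝔾(ι_ℓ ∘ ω, ℚ̄_ℓ ⊗ H¹_ét(A_∞))}` (such `m` are `N₀`-ISOTYPIC, ★ `BlockFieldCharacter`, and the isotypic component consists of block
values, ★ `OmegaHomIsotypicComponent`).  Binder for binder the socket `SocketIso` of the cell's S2′ assembly (`hφinj` is idle here and kept for that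
reason). [cite: Liu2021, p. 133 (D.3) and p. 140 (proof of Thm. D.6 (1), FJcycle.tex l. 5626)] [cite: Bump1997, §4.2 Prop. 4.2.3]
[cite: Lam2001FirstCourse, §3 Thm. (3.5) (pp. 33–35) and §22 Prop. (22.1) (p. 327)] [cite: BourbakiAlgebreVIII2012, §3 no. 2 (lemme de Schur)] -/
theorem exists_ringHom_forall_eigen_toTower_baseChange_mem_span_of_levelwise (hD : T.IsogenyDescent) [ρW.IsIrreducible]
    (hssM : ∀ K' : C5.SmallLevel C.S.K₀,
      IsSemisimpleModule ↥(Algebra.adjoin (AlgebraicClosure ℚ_[ℓ])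
        ((Set.range fun g : C.G => ((rationalTateAction (C.A K') ℓ (T.heckeEnd hD K' g)).dualMap).baseChange (AlgebraicClosure ℚ_[ℓ])) :
          Set (Module.End (AlgebraicClosure ℚ_[ℓ]) (AlgebraicClosure ℚ_[ℓ] ⊗[ℚ_[ℓ]] C.etaleH1 ℓ K'))))
        (AlgebraicClosure ℚ_[ℓ] ⊗[ℚ_[ℓ]] C.etaleH1 ℓ K'))
    (K : C5.SmallLevel C.S.K₀) (hHK : IsSemisimpleRing ↥(T.heckeImage hD K))
    (f : W →ₛₗ[(ι : ℂ →+* AlgebraicClosure ℚ_[ℓ])] AlgebraicClosure ℚ_[ℓ] ⊗[ℚ_[ℓ]] C.etaleH1Tower ℓ)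
    (hf : f ∈ X.omegaHom ι ρW) (hf0 : ∃ w ∈ ρW.fixedPoints (K.1.1 : Subgroup C.G), f w ≠ 0)
    (ε : (C.A K).endAlgebra) (hεH : ε ∈ T.heckeImage hD K)
    (hsel : ∀ w ∈ ρW.fixedPoints (K.1.1 : Subgroup C.G), ∀ x : (AlgebraicClosure ℚ_[ℓ]) ⊗[ℚ_[ℓ]] C.etaleH1 ℓ K,
        (C.toTower ℓ K).baseChange (AlgebraicClosure ℚ_[ℓ]) x = f w →
          (C.toTower ℓ K).baseChange (AlgebraicClosure ℚ_[ℓ])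
            (((rationalTateAction (C.A K) ℓ ε).dualMap).baseChange (AlgebraicClosure ℚ_[ℓ]) x) = f w)
    (R₀ : Type) [Field R₀] [NumberField R₀] (φ : R₀ →ₗ[ℚ] (C.A K).endAlgebra) (_hφinj : Function.Injective φ)
    (hφmul : ∀ a b, φ (a * b) = φ a * φ b) (hφ1 : φ 1 = ε) (hφH : ∀ r, φ r ∈ T.heckeImage hD K)
    (hφc : ∀ r, ∀ h ∈ T.heckeImage hD K, φ r * h = h * φ r)
    (hφsurj : ∀ z ∈ T.heckeImage hD K, (∀ y ∈ T.heckeImage hD K, z * y = y * z) → ∃ r : R₀, φ r = z * ε) :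
    ∃ τ₀ : R₀ →+* ℂ, ∀ m : AlgebraicClosure ℚ_[ℓ] ⊗[ℚ_[ℓ]] C.etaleH1 ℓ K,
      (∀ r : R₀, ((rationalTateAction (C.A K) ℓ (φ r)).dualMap).baseChange (AlgebraicClosure ℚ_[ℓ]) m = ι (τ₀ r) • m) →
        (C.toTower ℓ K).baseChange (AlgebraicClosure ℚ_[ℓ]) m ∈
          Submodule.span (AlgebraicClosure ℚ_[ℓ]) {y | ∃ f ∈ X.omegaHom ι ρW, ∃ w : W, f w = y} := by
  classical
  -- OPAQUE abbreviations: `j = [·]_K ⊗ 1`, `op x = ᵗV_ℓ^ℚ x ⊗ 1`, `S = {op (heckeEnd K g)}`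
  obtain ⟨j, hj⟩ : ∃ j : (AlgebraicClosure ℚ_[ℓ] ⊗[ℚ_[ℓ]] C.etaleH1 ℓ K) →ₗ[AlgebraicClosure ℚ_[ℓ]] AlgebraicClosure ℚ_[ℓ] ⊗[ℚ_[ℓ]] C.etaleH1Tower ℓ,
      j = (C.toTower ℓ K).baseChange (AlgebraicClosure ℚ_[ℓ]) := ⟨_, rfl⟩
  have hjinj : Function.Injective j := by
    rw [hj]
    exact toTower_baseChange_injective C ℓ (C.toTower_injective ℓ hI K)
  obtain ⟨op, hop⟩ : ∃ op : (C.A K).endAlgebra → Module.End (AlgebraicClosure ℚ_[ℓ]) (AlgebraicClosure ℚ_[ℓ] ⊗[ℚ_[ℓ]] C.etaleH1 ℓ K),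
      op = fun x => ((rationalTateAction (C.A K) ℓ x).dualMap).baseChange (AlgebraicClosure ℚ_[ℓ]) := ⟨_, rfl⟩
  have hop' : ∀ x, op x = ((rationalTateAction (C.A K) ℓ x).dualMap).baseChange (AlgebraicClosure ℚ_[ℓ]) := fun x => by rw [hop]
  have op_mul : ∀ x y, op (x * y) = op y * op x := fun x y => by
    rw [hop', hop', hop', Module.End.mul_eq_comp]
    exact baseChange_dualMap_rationalTateAction_mul ℓ K x y
  have op_add : ∀ x y, op (x + y) = op x + op y := fun x y => by
    rw [hop', hop', hop']
    exact baseChange_dualMap_rationalTateAction_add ℓ K x y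
  have op_zero : op 0 = 0 := by rw [hop', baseChange_dualMap_rationalTateAction_zero ℓ K]
  obtain ⟨S, hS⟩ : ∃ S : Set (Module.End (AlgebraicClosure ℚ_[ℓ]) (AlgebraicClosure ℚ_[ℓ] ⊗[ℚ_[ℓ]] C.etaleH1 ℓ K)),
      S = Set.range fun g : C.G => ((rationalTateAction (C.A K) ℓ (T.heckeEnd hD K g)).dualMap).baseChange (AlgebraicClosure ℚ_[ℓ]) := ⟨_, rfl⟩
  have hSop : S = Set.range fun g : C.G => op (T.heckeEnd hD K g) := by rw [hS, hop]
  have h𝒜gen : ∀ g : C.G, ((rationalTateAction (C.A K) ℓ (T.heckeEnd hD K g)).dualMap).baseChange (AlgebraicClosure ℚ_[ℓ]) ∈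
      Algebra.adjoin (AlgebraicClosure ℚ_[ℓ]) S := fun g => Algebra.subset_adjoin (by rw [hS]; exact ⟨g, rfl⟩)
  have hop𝒜 : ∀ x ∈ T.heckeImage hD K, op x ∈ Algebra.adjoin (AlgebraicClosure ℚ_[ℓ]) S := fun x hx => by
    rw [hop', hS]
    exact T.baseChange_dualMap_rationalTateAction_mem_adjoin ℓ K hD hx
  -- the algebra `𝒜 = ℚ̄_ℓ[S]` is semisimple (from `σ`), `ℚ̄_ℓ ⊗ H¹_ét(A_K)` finite-dimensional
  haveI := module_finite_baseChange_etaleH1 (C := C) ℓ K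
  haveI : IsSemisimpleModule ↥(Algebra.adjoin (AlgebraicClosure ℚ_[ℓ]) S) (AlgebraicClosure ℚ_[ℓ] ⊗[ℚ_[ℓ]] C.etaleH1 ℓ K) := by
    rw [hS]; exact hssM K
  haveI : IsSemisimpleRing ↥(Algebra.adjoin (AlgebraicClosure ℚ_[ℓ]) S) :=
    Literature.RingTheory.SimpleModule.isSemisimpleRing_of_isSemisimpleModule (Algebra.adjoin (AlgebraicClosure ℚ_[ℓ]) S)
  -- the block module `N₀ = [·]_K⁻¹ f′(ω^K)`, simple over `𝒜`
  obtain ⟨N₀, hN₀⟩ := T.exists_submodule_adjoin_restrictScalars_eq K X hX ι ρW hf hD S hS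
  have hN0 : N₀ ≠ ⊥ := T.ne_bot_of_restrictScalars_eq K hI X hX ι ρW hf hD hf0 N₀ hN₀
  have hcoe : (N₀ : Set (AlgebraicClosure ℚ_[ℓ] ⊗[ℚ_[ℓ]] C.etaleH1 ℓ K)) =
      ((ρW.fixedPoints (K.1.1 : Subgroup C.G)).map f).comap ((C.toTower ℓ K).baseChange (AlgebraicClosure ℚ_[ℓ])) := by
    rw [← Submodule.coe_restrictScalars (AlgebraicClosure ℚ_[ℓ]) N₀, hN₀]
  haveI hsimple := Literature.RingTheory.SimpleModule.isSimpleModule_of_forall_stable S N₀ hN0 fun U hU hUS => by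
    rw [hcoe] at hU ⊢
    rw [hS] at hUS
    exact T.eq_bot_or_coe_eq_of_forall_heckeEnd_stable K hI X hX ι ρW hf hD U hU hUS
  have hmemN₀ : ∀ x, x ∈ N₀ ↔ j x ∈ (ρW.fixedPoints (K.1.1 : Subgroup C.G)).map f := fun x => by
    rw [← Submodule.restrictScalars_mem (AlgebraicClosure ℚ_[ℓ]), hN₀, Submodule.mem_comap, hj]
  -- the block-field map `a = op ∘ φ : R₀ →+ 𝒜` (additive, anti-multiplicative, central values, `a 1 = op ε` fixes `N₀`)
  let a : R₀ →+ ↥(Algebra.adjoin (AlgebraicClosure ℚ_[ℓ]) S) :=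
    { toFun := fun r => ⟨op (φ r), hop𝒜 _ (hφH r)⟩
      map_zero' := Subtype.ext (by
        change op (φ 0) = 0
        rw [map_zero, op_zero])
      map_add' := fun r s => Subtype.ext (by
        change op (φ (r + s)) = op (φ r) + op (φ s)
        rw [map_add, op_add]) }
  have ha : ∀ r, ((a r : ↥(Algebra.adjoin (AlgebraicClosure ℚ_[ℓ]) S)) :
      Module.End (AlgebraicClosure ℚ_[ℓ]) (AlgebraicClosure ℚ_[ℓ] ⊗[ℚ_[ℓ]] C.etaleH1 ℓ K)) = op (φ r) := fun _ => rfl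
  have hmul : ∀ r s, a (r * s) = a s * a r := fun r s => Subtype.ext (by
    rw [Subalgebra.coe_mul, ha, ha, ha, hφmul, op_mul])
  have hcen : ∀ (r : R₀) (x : ↥(Algebra.adjoin (AlgebraicClosure ℚ_[ℓ]) S)), x * a r = a r * x := by
    intro r x
    apply Subtype.ext
    rw [Subalgebra.coe_mul, Subalgebra.coe_mul, ha]
    obtain ⟨x, hx⟩ := x
    change x * op (φ r) = op (φ r) * x
    induction hx using Algebra.adjoin_induction with
    | mem s hs =>
      rw [hSop] at hs
      obtain ⟨g, rfl⟩ := hs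
      rw [← op_mul, ← op_mul, hφc r _ (T.heckeEnd_mem_heckeImage hD K g)]
    | algebraMap c => exact Algebra.commutes c _
    | add x y _ _ hx hy => rw [add_mul, mul_add, hx, hy]
    | mul x y _ _ hx hy => rw [mul_assoc, hy, ← mul_assoc, hx, mul_assoc]
  have hone : ∀ n ∈ N₀, a 1 • n = n := by
    intro n hn
    obtain ⟨w, hw, hwn⟩ := Submodule.mem_map.1 ((hmemN₀ n).1 hn)
    rw [hj] at hwn
    have h1 := hsel w hw n hwn.symm
    apply hjinj
    rw [hj]
    change (C.toTower ℓ K).baseChange (AlgebraicClosure ℚ_[ℓ]) (op (φ 1) n) = _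
    rw [hφ1, hop', h1, hwn]
  -- `hZ`: central elements below `a 1 = op ε` are `ℚ̄_ℓ`-combinations of the `a r`
  have hZ : ∀ z : ↥(Algebra.adjoin (AlgebraicClosure ℚ_[ℓ]) S), (∀ x, z * x = x * z) → z * a 1 = z →
      z ∈ Submodule.span (AlgebraicClosure ℚ_[ℓ]) (Set.range a) := fun z hz hze =>
    T.mem_span_of_forall_comm_of_mul_eq_of_isSemisimpleRing K hD hHK S hS hεH φ hφH hφsurj (a 1) (by rw [ha, hφ1, hop']) a
      (fun r => by rw [ha, hop']) z hz hze
  -- Schur + isotypic membership (★ `BlockFieldCharacter`)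
  obtain ⟨τ, -, hτ⟩ := Literature.RingTheory.SimpleModule.exists_ringHom_forall_smul_eq_and_forall_mem_isotypicComponent
    (L := AlgebraicClosure ℚ_[ℓ]) N₀ a hmul hcen hone hZ
  refine ⟨ι.symm.toRingHom.comp τ, fun m hm => ?_⟩
  have hm' : ∀ r : R₀, a r • m = τ r • m := fun r => by
    have h := hm r
    rw [RingHom.comp_apply, RingEquiv.toRingHom_eq_coe, RingEquiv.coe_toRingHom, RingEquiv.apply_symm_apply, ← hop'] at h
    exact h
  have hmem := hτ m hm'
  -- the isotypic component consists of block values (★ `OmegaHomIsotypicComponent`)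
  letI : AddCommGroup ↥N₀ := @Submodule.addCommGroup _ _ (Subalgebra.toRing _) inferInstance _ N₀
  have hle := T.map_isotypicComponent_le_span_blockValues_of_levelwise K hI X hX ι ρW hf σ hσ hD hssM (Algebra.adjoin (AlgebraicClosure ℚ_[ℓ]) S) h𝒜gen N₀ hN₀
    ↥N₀ (LinearEquiv.refl _ _)
  exact hle (Submodule.mem_map_of_mem hmem)


include hI hX hσ in
/-- **`SocketIso` from «`heckeImage K′` is a semisimple ring for every small level `K′`»** — the one-hypothesis form (`hH`) of
`exists_ringHom_forall_eigen_toTower_baseChange_mem_span_of_levelwise`: `hssM K′` is ★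
`isSemisimpleModule_baseChange_etaleH1_of_isSemisimpleRing_heckeImage (hH K′)` (A-p10 (g12): `𝒜_{K′}` is a quotient of the semisimple
`ℚ̄_ℓ ⊗_ℚ (heckeImage K′)ᵐᵒᵖ`) and `hHK := hH K`.  Under road (P) of the cell's d6 line `hH` is ★
`isSemisimpleRing_heckeImage_of_forall_exists_isPositiveAntiInvolution` applied to `SocketRos`, so the S1c citation leaves the `SocketIso` column.
[cite: Liu2021, p. 133 (D.3) and p. 140 (proof of Thm. D.6 (1), FJcycle.tex l. 5626)] [cite: MumfordAV1970, §21 Thm. 1] [cite: Bump1997, §4.2 Prop. 4.2.3] -/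
theorem exists_ringHom_forall_eigen_toTower_baseChange_mem_span_of_isSemisimpleRing_heckeImage (hD : T.IsogenyDescent) [ρW.IsIrreducible]
    (hH : ∀ K' : C5.SmallLevel C.S.K₀, IsSemisimpleRing ↥(T.heckeImage hD K'))
    (K : C5.SmallLevel C.S.K₀)
    (f : W →ₛₗ[(ι : ℂ →+* AlgebraicClosure ℚ_[ℓ])] AlgebraicClosure ℚ_[ℓ] ⊗[ℚ_[ℓ]] C.etaleH1Tower ℓ)
    (hf : f ∈ X.omegaHom ι ρW) (hf0 : ∃ w ∈ ρW.fixedPoints (K.1.1 : Subgroup C.G), f w ≠ 0)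
    (ε : (C.A K).endAlgebra) (hεH : ε ∈ T.heckeImage hD K)
    (hsel : ∀ w ∈ ρW.fixedPoints (K.1.1 : Subgroup C.G), ∀ x : (AlgebraicClosure ℚ_[ℓ]) ⊗[ℚ_[ℓ]] C.etaleH1 ℓ K,
        (C.toTower ℓ K).baseChange (AlgebraicClosure ℚ_[ℓ]) x = f w →
          (C.toTower ℓ K).baseChange (AlgebraicClosure ℚ_[ℓ])
            (((rationalTateAction (C.A K) ℓ ε).dualMap).baseChange (AlgebraicClosure ℚ_[ℓ]) x) = f w)
    (R₀ : Type) [Field R₀] [NumberField R₀] (φ : R₀ →ₗ[ℚ] (C.A K).endAlgebra) (_hφinj : Function.Injective φ)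
    (hφmul : ∀ a b, φ (a * b) = φ a * φ b) (hφ1 : φ 1 = ε) (hφH : ∀ r, φ r ∈ T.heckeImage hD K)
    (hφc : ∀ r, ∀ h ∈ T.heckeImage hD K, φ r * h = h * φ r)
    (hφsurj : ∀ z ∈ T.heckeImage hD K, (∀ y ∈ T.heckeImage hD K, z * y = y * z) → ∃ r : R₀, φ r = z * ε) :
    ∃ τ₀ : R₀ →+* ℂ, ∀ m : AlgebraicClosure ℚ_[ℓ] ⊗[ℚ_[ℓ]] C.etaleH1 ℓ K,
      (∀ r : R₀, ((rationalTateAction (C.A K) ℓ (φ r)).dualMap).baseChange (AlgebraicClosure ℚ_[ℓ]) m = ι (τ₀ r) • m) →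
        (C.toTower ℓ K).baseChange (AlgebraicClosure ℚ_[ℓ]) m ∈
          Submodule.span (AlgebraicClosure ℚ_[ℓ]) {y | ∃ f ∈ X.omegaHom ι ρW, ∃ w : W, f w = y} :=
  T.exists_ringHom_forall_eigen_toTower_baseChange_mem_span_of_levelwise ℓ hI X hX ι ρW σ hσ hD
    (fun K' => T.isSemisimpleModule_baseChange_etaleH1_of_isSemisimpleRing_heckeImage ℓ K' hD (hH K') _ rfl)
    K (hH K) f hf hf0 ε hεH hsel R₀ φ _hφinj hφmul hφ1 hφH hφc hφsurj

end Sec42Data.HeckeTranslates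

end Literature.NumberTheory.Automorphic.Liu2021.AppendixC

end
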